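import Summits.Ventures.PercRepro.ProfilePointedCircuitClassesStarSharpD0V

/-!
# PercRepro — CASE D0 OF `StarNineSharp`, PART W: EVERY `ef`-PLANE DEMAND HAS A TARGET
(p5, gen 55; `proofs/P5-GM1.md` §82 (b))

With the trace `T = {x, y, z}` of the ON plane `H` through `e, f` and `W = {w, w′} = X ∖ H`, an `ef`-plane demand
`π = {x, y}` (opposite vertex `z`) — `ρ(π + e) = 3`, `(X − π) + f` a basis, R0 failing — has, for a `b`-generic `b`
(`ρ{t, b, b′} = 3` on `X`), one of the targets of part U (`efplane_demand_target`):
* `z` is a C-point (`ρ{e, f, z} = 3`, `ρ(X − z) = 4`), or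
* `ρ{e, f, z} = 3` and some `X − z − w̃` is OFF (the R4a′-type pair `(z, w̄)`), or
* an endpoint `x̃ ∈ π` with `ρ{e, f, x̃} = 3` whose opposite line `T − x̃` is OFF — then `X − x̃ − w̃` is OFF for BOTH
  `w̃ ∈ W` (`off_triple_of_line_off`, the cut lemma): the R4c-type pairs `(x̃, w)`, `(x̃, w′)`.
The proof: if `ρ{e, f, z} = 3` and `X − z` is a plane, it is OFF (second case) or ON — then the line `π` is ON and,
`b` being generic, neither line through `z` is (`not_both_lines_on`); if `z` lies on the line `ef`, R0 fails through
`ρ(π + f) = 2`, so `π` is a line through `f`, neither endpoint is on the line `ef`, and again one line through `z` is OFF.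
-/

open scoped Matroid

namespace PercRepro.Cogirth

open Finset ThmH Skew Shadow Profile

open Classical

variable {α : Type} [DecidableEq α] {N : Matroid α} [N.Finite]

section StarSharpD0W

variable {b b' : α}

/-- **EVERY `ef`-PLANE DEMAND HAS A TARGET** (`b`-generic; trace `{x, y, z}`, `W = {w, w′}`, demand `{x, y}` with
opposite vertex `z`): `z` is a C-point, or `ρ{e, f, z} = 3` with `{x, y, w′}` or `{x, y, w}` OFF, or an endpoint
`x̃ ∈ {x, y}` has `ρ{e, f, x̃} = 3` and both triples `(T − x̃) + w̃` OFF. -/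
theorem efplane_demand_target (h : SeriesPair N b b') (hR : rk N (gr N) = 5)
    (hE7 : rk N (((gr N).erase b).erase b') = 4) {e f : α}
    (he : e ∈ gr N) (hf : f ∈ gr N) (hef : e ≠ f) (heb : e ≠ b) (heb' : e ≠ b') (hfb : f ≠ b) (hfb' : f ≠ b')
    (he1 : ∀ y ∈ ((((gr N).erase b).erase b').erase f).erase e, rk N {e, y} = 2)
    (hf1 : ∀ y ∈ ((((gr N).erase b).erase b').erase f).erase e, rk N {f, y} = 2)
    (hX : rk N (((((gr N).erase b).erase b').erase f).erase e) = 4) (hef2 : rk N {e, f} = 2)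
    (hbg : ∀ y ∈ ((((gr N).erase b).erase b').erase f).erase e, rk N {y, b, b'} = 3)
    {H : Finset α} (hH : H ⊆ ((gr N).erase b).erase b') (hH3 : rk N H = 3)
    (hHon : rk N (insert b (insert b' H)) = 4)
    (hHfl : ∀ z ∈ ((gr N).erase b).erase b', z ∉ H → rk N (insert z H) = 4)
    {x y z w w' : α} (hxy : x ≠ y) (hxz : x ≠ z) (hyz : y ≠ z) (hww : w ≠ w')
    (hx : x ∈ ((((gr N).erase b).erase b').erase f).erase e) (hy : y ∈ ((((gr N).erase b).erase b').erase f).erase e)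
    (hz : z ∈ ((((gr N).erase b).erase b').erase f).erase e) (hw : w ∈ ((((gr N).erase b).erase b').erase f).erase e)
    (hw' : w' ∈ ((((gr N).erase b).erase b').erase f).erase e)
    (hxH : x ∈ H) (hyH : y ∈ H) (hzH : z ∈ H) (hwH : w ∉ H) (hw'H : w' ∉ H)
    (hXeq : ((((gr N).erase b).erase b').erase f).erase e = {x, y, z, w, w'})
    (hY : rk N (insert e {x, y}) = 3) (hYc : rk N (insert f {z, w, w'}) = 4)
    (hR0 : ¬ (rk N (insert f {x, y}) = 3 ∧ rk N (insert e {z, w, w'}) = 4)) :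
    (rk N {e, f, z} = 3 ∧ rk N {x, y, w, w'} = 4) ∨
    (rk N {e, f, z} = 3 ∧ (rk N (insert b (insert b' {x, y, w'})) = 5 ∨ rk N (insert b (insert b' {x, y, w})) = 5)) ∨
    (rk N {e, f, x} = 3 ∧ rk N (insert b (insert b' {y, z, w})) = 5 ∧ rk N (insert b (insert b' {y, z, w'})) = 5) ∨
    (rk N {e, f, y} = 3 ∧ rk N (insert b (insert b' {x, z, w})) = 5 ∧ rk N (insert b (insert b' {x, z, w'})) = 5) := by
  have hXE : ((((gr N).erase b).erase b').erase f).erase e ⊆ ((gr N).erase b).erase b' :=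
    (erase_subset _ _).trans (erase_subset _ _)
  have hE7g : ((gr N).erase b).erase b' ⊆ gr N := (erase_subset _ _).trans (erase_subset _ _)
  have hxE := hXE hx
  have hyE := hXE hy
  have hzE := hXE hz
  have hwE := hXE hw
  have hw'E := hXE hw'
  have hxg := hE7g hxE
  have hyg := hE7g hyE
  have hzg := hE7g hzE
  have hwg := hE7g hwE
  have hw'g := hE7g hw'E
  have heg := he
  have hfg := hf
  have hxw : x ≠ w := fun h' => hwH (h' ▸ hxH)
  have hxw' : x ≠ w' := fun h' => hw'H (h' ▸ hxH)
  have hyw : y ≠ w := fun h' => hwH (h' ▸ hyH)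
  have hyw' : y ≠ w' := fun h' => hw'H (h' ▸ hyH)
  have hzw : z ≠ w := fun h' => hwH (h' ▸ hzH)
  have hzw' : z ≠ w' := fun h' => hw'H (h' ▸ hzH)
  have hxe : x ≠ e := (mem_erase.1 hx).1
  have hye : y ≠ e := (mem_erase.1 hy).1
  have hze : z ≠ e := (mem_erase.1 hz).1
  have hxf : x ≠ f := (mem_erase.1 (mem_erase.1 hx).2).1
  have hyf : y ≠ f := (mem_erase.1 (mem_erase.1 hy).2).1
  have hzf : z ≠ f := (mem_erase.1 (mem_erase.1 hz).2).1
  -- the pair `{x, y}` is a line (from `ρ(π + e) = 3`)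
  have hxy2 : rk N ({x, y} : Finset α) = 2 := by
    have h1 := rk_insert_le_add_one (N := N) he (X := ({x, y} : Finset α)) (by
      intro a ha; simp only [mem_insert, mem_singleton] at ha; rcases ha with rfl | rfl <;> assumption)
    have h2 := rk_le_card' (M := N) ({x, y} : Finset α)
    rw [card_pair hxy] at h2
    omega
  have hxyH : ({x, y} : Finset α) ⊆ H := by
    intro a ha; simp only [mem_insert, mem_singleton] at ha; rcases ha with rfl | rfl <;> assumption
  -- `ρ{x, y, w̃} = 3` for `w̃ ∉ H`
  have hxyw3 : rk N ({x, y, w} : Finset α) = 3 := by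
    rw [triple_eq_insert_last, rk_insert_eq_add_one_of_subset_flat (N := N) (H := H) (S := ({x, y} : Finset α)) (z := w) hwg
      (hH.trans hE7g) hxyH (by rw [hHfl w hwE hwH, hH3]), hxy2]
  have hxyw'3 : rk N ({x, y, w'} : Finset α) = 3 := by
    rw [triple_eq_insert_last, rk_insert_eq_add_one_of_subset_flat (N := N) (H := H) (S := ({x, y} : Finset α)) (z := w') hw'g
      (hH.trans hE7g) hxyH (by rw [hHfl w' hw'E hw'H, hH3]), hxy2]
  -- membership / subset helpers
  have heE : e ∈ ((gr N).erase b).erase b' := mem_erase.2 ⟨heb', mem_erase.2 ⟨heb, he⟩⟩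
  have hfE : f ∈ ((gr N).erase b).erase b' := mem_erase.2 ⟨hfb', mem_erase.2 ⟨hfb, hf⟩⟩
  have hle4 : ∀ S : Finset α, S ⊆ ((gr N).erase b).erase b' → rk N S ≤ 4 := by
    intro S hS; rw [← hE7]; exact rk_mono' hS
  have hPE : ({x, y, w, w'} : Finset α) ⊆ ((gr N).erase b).erase b' := by
    intro a ha; simp only [mem_insert, mem_singleton] at ha
    rcases ha with rfl | rfl | rfl | rfl <;> assumption
  -- a pair of a rank-3 triple has rank 2
  have hpair2 : ∀ p q r : α, r ∈ gr N → p ∈ gr N → q ∈ gr N → rk N {p, q, r} = 3 → rk N {p, q} = 2 := by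
    intro p q r hr hp hq h3
    rw [triple_eq_insert_last] at h3
    have h1 := rk_insert_le_add_one (N := N) hr (X := ({p, q} : Finset α)) (by
      intro a ha; simp only [mem_insert, mem_singleton] at ha; rcases ha with rfl | rfl <;> assumption)
    have h2 := rk_le_card' (M := N) ({p, q} : Finset α)
    have h4 : ({p, q} : Finset α).card ≤ 2 := by
      calc ({p, q} : Finset α).card ≤ ({q} : Finset α).card + 1 := card_insert_le _ _
        _ = 2 := by rw [card_singleton]
    omega
  -- the OFF triples of an OFF line of the trace (both points of `W`)
  have hoffT : ∀ p q : α, p ∈ ((gr N).erase b).erase b' → p ∈ H → q ∈ ((gr N).erase b).erase b' → q ∈ H →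
      rk N {p, q} = 2 → rk N (insert b (insert b' {p, q})) ≠ 3 →
      rk N (insert b (insert b' {p, q, w})) = 5 ∧ rk N (insert b (insert b' {p, q, w'})) = 5 := by
    intro p q hp hpH hq hqH hpq hoff
    exact ⟨off_triple_of_line_off h hR hE7 hH hH3 hHon hHfl hp hpH hq hqH hwE hwH hpq hoff,
      off_triple_of_line_off h hR hE7 hH hH3 hHon hHfl hp hpH hq hqH hw'E hw'H hpq hoff⟩
  have hxyz_c : ({x, y, z} : Finset α).card = 3 := by
    rw [card_insert_of_notMem, card_pair hyz]
    simp only [mem_insert, mem_singleton, not_or]; exact ⟨hxy, hxz⟩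
  have exzy : ({x, z, y} : Finset α) = {x, y, z} := triple_swap23 x y z
  have eyzx : ({y, z, x} : Finset α) = {x, y, z} := triple_rot' x y z
  by_cases hefz : rk N ({e, f, z} : Finset α) = 3
  · -- CASE A: `z` is off the line `ef`
    by_cases hXz : rk N ({x, y, w, w'} : Finset α) = 4
    · exact Or.inl ⟨hefz, hXz⟩
    · have hP3 : rk N ({x, y, w, w'} : Finset α) = 3 := by
        have h1 : rk N ({x, y, w} : Finset α) ≤ rk N ({x, y, w, w'} : Finset α) :=
          rk_mono' (triple_subset_quad x y w w')
        have h2 := hle4 _ hPE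
        omega
      by_cases hPon : rk N (insert b (insert b' ({x, y, w, w'} : Finset α))) = 4
      · -- A2: the plane `X − z` is ON, so the line `{x, y}` is ON
        have hU : rk N (({x, y, w, w'} : Finset α) ∪ H) = 4 := by
          apply le_antisymm
          · rw [← hE7]; exact rk_mono' (union_subset hPE hH)
          · rw [← hHfl w hwE hwH]
            exact rk_mono' (insert_subset (mem_union_left _ (mem_insert_of_mem (mem_insert_of_mem (mem_insert_self _ _))))
              subset_union_right)
        have hxyon : rk N (insert b (insert b' ({x, y} : Finset α))) = 3 :=
          on_line_of_two_on_planes h hR hPE hH hPon hHon hU (pair_subset_quad_inter hxH hyH w w') hxy2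
        -- `z ∉ cl{x, y}`: else `X = (X − z) + z` would have rank 3
        have hxyz3 : rk N ({x, y, z} : Finset α) = 3 := by
          have h2 := rk_le_card' (M := N) ({x, y, z} : Finset α)
          rw [hxyz_c] at h2
          by_contra hne
          have hmono : rk N ({x, y} : Finset α) ≤ rk N ({x, y, z} : Finset α) :=
            rk_mono' (pair_ef_subset_eft x y z)
          have hzxy : rk N (insert z ({x, y} : Finset α)) = rk N ({x, y} : Finset α) := by
            rw [← triple_eq_insert_last]; omega
          have h4 := rk_insert_eq_of_rk_insert_eq_subset' (N := N) (S := ({x, y} : Finset α))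
            (S' := ({x, y, w, w'} : Finset α)) (w := z) (pair_subset_quad x y w w') hzxy
          rw [insert_quad_eq, ← hXeq, hX, hP3] at h4
          omega
        have hyz2 : rk N ({y, z} : Finset α) = 2 := hpair2 y z x hxg hyg hzg (by rw [eyzx]; exact hxyz3)
        have hxz2 : rk N ({x, z} : Finset α) = 2 := hpair2 x z y hyg hxg hzg (by rw [exzy]; exact hxyz3)
        -- both lines through `z` are OFF (`b` generic at `y` and at `x`)
        have hyzoff : rk N (insert b (insert b' ({y, z} : Finset α))) ≠ 3 := by
          intro hon
          apply not_both_lines_on h hxE hzE hyE (hbg y hy) (by rw [exzy]; exact hxyz3)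
          refine ⟨hxyon, ?_⟩
          rw [pair_comm' z y]; exact hon
        have hxzoff : rk N (insert b (insert b' ({x, z} : Finset α))) ≠ 3 := by
          intro hon
          apply not_both_lines_on h hyE hzE hxE (hbg x hx) (by rw [eyzx]; exact hxyz3)
          refine ⟨?_, ?_⟩
          · rw [pair_comm' y x]; exact hxyon
          · rw [pair_comm' z x]; exact hon
        by_cases hefx : rk N ({e, f, x} : Finset α) = 3
        · obtain ⟨h1, h2⟩ := hoffT y z hyE hyH hzE hzH hyz2 hyzoff
          exact Or.inr (Or.inr (Or.inl ⟨hefx, h1, h2⟩))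
        · have hefy : rk N ({e, f, y} : Finset α) = 3 := by
            by_contra hne
            have hefsub : ({e, f} : Finset α) ⊆ gr N := by
              intro a ha; simp only [mem_insert, mem_singleton] at ha; rcases ha with rfl | rfl <;> assumption
            have hx2 : rk N (insert x ({e, f} : Finset α)) = rk N ({e, f} : Finset α) := by
              have h1 := rk_insert_le_add_one (N := N) hxg hefsub
              have h2 : rk N ({e, f} : Finset α) ≤ rk N (insert x ({e, f} : Finset α)) := rk_mono' (subset_insert _ _)
              rw [← triple_eq_insert_last] at h1 h2 ⊢; omega
            have hy2 : rk N (insert y ({e, f} : Finset α)) = rk N ({e, f} : Finset α) := by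
              have h1 := rk_insert_le_add_one (N := N) hyg hefsub
              have h2 : rk N ({e, f} : Finset α) ≤ rk N (insert y ({e, f} : Finset α)) := rk_mono' (subset_insert _ _)
              rw [← triple_eq_insert_last] at h1 h2 ⊢; omega
            have h3 := rk_insert_eq_of_rk_insert_eq_subset' (N := N) (S := ({e, f} : Finset α))
              (S' := insert x ({e, f} : Finset α)) (w := y) (subset_insert _ _) hy2
            have h4 : rk N (insert e ({x, y} : Finset α)) ≤ rk N (insert y (insert x ({e, f} : Finset α))) :=
              rk_mono' (insert_pair_subset_insert_insert e f x y)
            rw [hY, h3, hx2, hef2] at h4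
            omega
          obtain ⟨h1, h2⟩ := hoffT x z hxE hxH hzE hzH hxz2 hxzoff
          exact Or.inr (Or.inr (Or.inr ⟨hefy, h1, h2⟩))
      · -- A1: the plane `X − z` is OFF, and `{x, y, w'}` spans it
        have hP5 := rk_insert_bb'_eq_five_of_not_on h hPE hP3 hPon
        refine Or.inr (Or.inl ⟨hefz, Or.inl ?_⟩)
        have e1 : insert w ({x, y, w'} : Finset α) = {x, y, w, w'} := insert_triple_eq_quad x y w w'
        have hsp : rk N (insert w ({x, y, w'} : Finset α)) = rk N ({x, y, w'} : Finset α) := by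
          rw [e1, hP3, hxyw'3]
        have := rk_insert_bb'_insert_eq_of_rk_insert_eq (N := N) (b := b) (b' := b') hsp
        rw [e1, hP5] at this
        exact this.symm
  · -- CASE B: `z` lies on the line `ef`
    have hefz2 : rk N ({e, f, z} : Finset α) = 2 := by
      have h1 : rk N ({e, z} : Finset α) ≤ rk N ({e, f, z} : Finset α) :=
        rk_mono' (pair_et_subset_eft e f z)
      have h2 := rk_le_card' (M := N) ({e, f, z} : Finset α)
      have hc : ({e, f, z} : Finset α).card = 3 := by
        rw [card_insert_of_notMem, card_pair hzf.symm]
        simp only [mem_insert, mem_singleton, not_or]; exact ⟨hef, hze.symm⟩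
      rw [hc] at h2
      rw [he1 z hz] at h1
      omega
    -- (B1) `f ∈ cl{e, z}` forces `ρ(insert e (X − π)) = 4`
    have hB1 : rk N (insert e ({z, w, w'} : Finset α)) = 4 := by
      have hfez : rk N (insert f ({e, z} : Finset α)) = rk N ({e, z} : Finset α) := by
        rw [insert_pair_eq_mid, hefz2, he1 z hz]
      have h1 := rk_insert_eq_of_rk_insert_eq_subset' (N := N) (S := ({e, z} : Finset α))
        (S' := insert e ({z, w, w'} : Finset α)) (w := f) (pair_subset_insert_triple e z w w') hfez
      have h2 : rk N (insert f ({z, w, w'} : Finset α)) ≤ rk N (insert f (insert e ({z, w, w'} : Finset α))) :=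
        rk_mono' (insert_subset_insert _ (subset_insert _ _))
      have h3 := hle4 (insert e ({z, w, w'} : Finset α)) (by
        intro a ha; simp only [mem_insert, mem_singleton] at ha
        rcases ha with rfl | rfl | rfl | rfl <;> assumption)
      rw [hYc] at h2
      omega
    -- (B2) R0 fails through `ρ(π + f) = 2`
    have hB2 : rk N (insert f ({x, y} : Finset α)) = 2 := by
      have h1 := rk_insert_le_add_one (N := N) hfg (X := ({x, y} : Finset α)) (by
        intro a ha; simp only [mem_insert, mem_singleton] at ha; rcases ha with rfl | rfl <;> assumption)
      have h2 : rk N ({x, y} : Finset α) ≤ rk N (insert f ({x, y} : Finset α)) := rk_mono' (subset_insert _ _)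
      have h3 : ¬ rk N (insert f ({x, y} : Finset α)) = 3 := fun h' => hR0 ⟨h', hB1⟩
      omega
    -- `e ∈ cl{f, z}`
    have hefz' : rk N (insert e ({f, z} : Finset α)) = rk N ({f, z} : Finset α) := by
      rw [insert_pair_eq_first, hefz2, hf1 z hz]
    -- (B3) the trace is not collinear
    have hxyz3 : rk N ({x, y, z} : Finset α) = 3 := by
      by_contra hne
      have h2 := rk_le_card' (M := N) ({x, y, z} : Finset α)
      rw [hxyz_c] at h2
      have hmono : rk N ({x, y} : Finset α) ≤ rk N ({x, y, z} : Finset α) :=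
        rk_mono' (pair_ef_subset_eft x y z)
      have hzxy : rk N (insert z ({x, y} : Finset α)) = rk N ({x, y} : Finset α) := by
        rw [← triple_eq_insert_last]; omega
      have h4 := rk_insert_eq_of_rk_insert_eq_subset' (N := N) (S := ({x, y} : Finset α))
        (S' := insert f ({x, y} : Finset α)) (w := z) (subset_insert _ _) hzxy
      have h5 := rk_insert_eq_of_rk_insert_eq_subset' (N := N) (S := ({f, z} : Finset α))
        (S' := insert z (insert f ({x, y} : Finset α))) (w := e) (pair_subset_insert_insert_pair f z x y) hefz'
      have h6 : rk N (insert e ({x, y} : Finset α)) ≤ rk N (insert e (insert z (insert f ({x, y} : Finset α)))) :=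
        rk_mono' (insert_subset_insert _ ((subset_insert _ _).trans (subset_insert _ _)))
      rw [hY, h5, h4, hB2] at h6
      omega
    -- (B4) neither endpoint is on the line `ef`
    have hend : ∀ p q : α, p ∈ gr N → p ∈ ((((gr N).erase b).erase b').erase f).erase e →
        insert f ({p, q} : Finset α) = insert f {x, y} → insert e ({p, q} : Finset α) = insert e {x, y} →
        rk N {e, f, p} = 3 := by
      intro p q hpg hpX hfpq hepq
      by_contra hne
      have hefp2 : rk N ({e, f, p} : Finset α) = 2 := by
        have h1 : rk N ({e, f} : Finset α) ≤ rk N ({e, f, p} : Finset α) :=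
          rk_mono' (pair_ef_subset_eft e f p)
        have h2 := rk_le_card' (M := N) ({e, f, p} : Finset α)
        have hc : ({e, f, p} : Finset α).card ≤ 3 := by
          calc ({e, f, p} : Finset α).card ≤ ({f, p} : Finset α).card + 1 := card_insert_le _ _
            _ ≤ ({p} : Finset α).card + 1 + 1 := by gcongr; exact card_insert_le _ _
            _ = 3 := by rw [card_singleton]
        rw [hef2] at h1
        omega
      have h1 : rk N (insert e ({f, p} : Finset α)) = rk N ({f, p} : Finset α) := by
        rw [insert_pair_eq_first, hefp2, hf1 p hpX]
      have h2 := rk_insert_eq_of_rk_insert_eq_subset' (N := N) (S := ({f, p} : Finset α))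
        (S' := insert f ({p, q} : Finset α)) (w := e) (pair_subset_insert_pair f p q) h1
      have h3 : rk N (insert e ({p, q} : Finset α)) ≤ rk N (insert e (insert f ({p, q} : Finset α))) :=
        rk_mono' (insert_subset_insert _ (subset_insert _ _))
      rw [hepq, hY, h2, hfpq, hB2] at h3
      omega
    have hefx : rk N ({e, f, x} : Finset α) = 3 := hend x y hxg hx rfl rfl
    have hefy : rk N ({e, f, y} : Finset α) = 3 := hend y x hyg hy (by rw [pair_comm' y x]) (by rw [pair_comm' y x])
    -- (B5) one of the two lines through `z` is OFF (`b` generic at `z`)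
    have hnb := not_both_lines_on h hxE hyE hzE (hbg z hz) hxyz3
    have hxz2 : rk N ({x, z} : Finset α) = 2 := hpair2 x z y hyg hxg hzg (by rw [exzy]; exact hxyz3)
    have hyz2 : rk N ({y, z} : Finset α) = 2 := hpair2 y z x hxg hyg hzg (by rw [eyzx]; exact hxyz3)
    by_cases hyzon : rk N (insert b (insert b' ({y, z} : Finset α))) = 3
    · have hxzoff : rk N (insert b (insert b' ({x, z} : Finset α))) ≠ 3 := fun h' => hnb ⟨h', hyzon⟩
      obtain ⟨h1, h2⟩ := hoffT x z hxE hxH hzE hzH hxz2 hxzoff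
      exact Or.inr (Or.inr (Or.inr ⟨hefy, h1, h2⟩))
    · obtain ⟨h1, h2⟩ := hoffT y z hyE hyH hzE hzH hyz2 hyzon
      exact Or.inr (Or.inr (Or.inl ⟨hefx, h1, h2⟩))

end StarSharpD0W

end PercRepro.Cogirth
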